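import Mathlib
import HarnessLib
import Literature.MathematicalPhysics.QuantumLattice.HubbardSliceSymbolSmoothOmegaThird
import Summits.HubbardSuperconductivity.HubbardSuperconductivity.Theorems.KLProgrammeKLRegimeSliceSymbolTorus
import Summits.HubbardSuperconductivity.HubbardSuperconductivity.Theorems.KLProgrammeKLRegimeSliceSymbolLineThree

/-!
# Route `KLProgramme` — engine support (route (L2), weighted lines): the counterterm slice symbol ON THE SPACE-TIME DUAL TORUS at
# ORDER THREE — pointwise third differences in time and along integer directions are those of the continuum function

Cell `gate-hubbard-kl`, seat hubbard-kl-k3c3-p2 (g8), for the ENGINE child stmt-HubbardSuperconductivity-20437 (`stub_engine_step_norms`: the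
WEIGHTED lines `KernelNormsWt4 … K_n j` / (E4)ₙ; located risk «(b)-Wt@j≥1»).  The order-three twin of §3 of k3c2-p3's
`KLProgrammeKLRegimeSliceSymbolTorus`: the symbol of the zero-seed counterterm slice covariance transported to the product torus
`(ℤ/2M)¹ × (ℤ/L)²`, `q ↦ Ψ̂_{ω(q₁)}(e_K(c(q₂)))` (`hubbardCovSliceCT_eq_normalCovariance_sliceSymbolFnXi`), has

* §1 (bookkeeping) `fwdDiff_iter_eq_of_samples_eq`, `fwdDiff_iter_eq_zero_of_samples_eq_zero` — iterated differences only read the `N+1` samples;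
  `abs_gridFreq_ge_of_le` — the padded frequencies of the indices `≤ k` and `≥ 2M−1−k` are `≥ π(2M−2k−1)/β` in absolute value;
* §2 **`norm_fwdDiff_three_space_sliceSymbolTorus_le`** (`_of_le`) — THIRD spatial differences along `(0, r̄)` are those of
  `p ↦ Ψ̂_ω(frameLevel μ K p)` along `w = (2π/L)r` (`fwdDiff_iter_space_sliceSymbolTorus_eq`, periodicity), hence bounded by
  `KLProgrammeKLRegimeSliceSymbolLineThree.norm_fwdDiff_three_sliceSymbol_line_le` with the band's `‖D²e_K‖ ≤ K₂`, `‖D³e_K‖ ≤ K₃`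
  (anisotropic first-order term `|De_K(c(q₂))·w|` explicit; `D³e_K` enters linearly);
* §3 **`norm_fwdDiff_three_time_sliceSymbolTorus_le`** — THIRD time differences bounded by `(2π/β)³·(64B₃+480B₂+1728B₁+1536)c/Λ⁴` when
  `Λ′ < π(2M−5)/β` (inside the window the four frequencies are consecutive Matsubara frequencies and Literature's
  `HubbardSliceSymbolSmoothOmegaThird.norm_fwdDiff_iter_three_sliceSymbolFn_le` applies; at the seam all four samples vanish).

These are the by-name inputs `(h₁, h₂, h₃′)` resp. `(h₀)` of the mixed master lemma
`KLProgrammeKLRegimeTorusL1MixedDifferencesMoment.sum_wt_norm_charSum_le_of_mixed_differences` for the propagator factor at any admissible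
frame and slice.  Everything is proved; no definitions, no named facts. [folklore]

References: G. Benfatto, A. Giuliani, V. Mastropietro, Ann. Henri Poincaré 7 (2006) 809–898, (2.36aa), Lemma 2.2 (2.52)–(2.55) and footnote ¹;
M. Salmhofer, *Renormalization* (1999), §4.2.4–4.2.5 (4.63), (4.70)–(4.71).
-/

noncomputable section

namespace Summit.HubbardSuperconductivity.HubbardSuperconductivity.Theorems.TorusFourierL2

set_option linter.dupNamespace false -- summit = problem name (single-conjunct summit), D-0017

open Set Complex Finset Literature.MathematicalPhysics.QuantumLattice Literature.Probability.LatticeModels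
open Summit.HubbardSuperconductivity.HubbardSuperconductivity.Theorems.DispersionFlow
open scoped Real

/-! ### §1 Bookkeeping: iterated differences read `N+1` samples; the padded frequencies near the seam -/

section Samples

/-- **Iterated forward differences only read the samples**: if `g(x + k•u) = f(y + k•δ)` for all `k ≤ N`, then
`(Δ_u)ᴺ g (x) = (Δ_δ)ᴺ f (y)`. [folklore] -/
theorem fwdDiff_iter_eq_of_samples_eq {A A' E : Type*} [AddCommMonoid A] [AddCommMonoid A'] [AddCommGroup E]
    (u : A) (δ : A') (g : A → E) (f : A' → E) (N : ℕ) (x : A) (y : A')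
    (hs : ∀ k ≤ N, g (x + k • u) = f (y + k • δ)) : (fwdDiff u)^[N] g x = (fwdDiff δ)^[N] f y := by
  rw [fwdDiff_iter_eq_sum_shift, fwdDiff_iter_eq_sum_shift]
  refine sum_congr rfl fun k hk => ?_
  rw [hs k (by simpa [Nat.lt_succ_iff] using hk)]

/-- If all `N+1` samples vanish, so does the `N`-th difference. [folklore] -/
theorem fwdDiff_iter_eq_zero_of_samples_eq_zero {A E : Type*} [AddCommMonoid A] [AddCommGroup E] (u : A) (g : A → E) (N : ℕ) (x : A)
    (hs : ∀ k ≤ N, g (x + k • u) = 0) : (fwdDiff u)^[N] g x = 0 := by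
  rw [fwdDiff_iter_eq_sum_shift]
  refine sum_eq_zero fun k hk => ?_
  rw [hs k (by simpa [Nat.lt_succ_iff] using hk), smul_zero]

variable {M N : ℕ} [NeZero N] {β : ℝ}

omit [NeZero N] in
/-- **The padded frequencies of the indices `≤ k` and `≥ 2M−1−k` are large**: `π(2M−2k−1)/β ≤ |gridFreq M N β q₀|` (`0 < β`).
[cite: Salmhofer1999, §4.2.5 (4.71)] -/
theorem abs_gridFreq_ge_of_le (hβ : 0 < β) (k : ℕ) (q₀ : TorusSite 1 N) (h : (q₀ 0).val ≤ k ∨ 2 * M ≤ (q₀ 0).val + k + 1) :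
    π * (2 * M - 2 * k - 1) / β ≤ |gridFreq M N β q₀| := by
  unfold gridFreq
  rw [abs_div, abs_of_pos hβ, abs_mul, abs_of_pos Real.pi_pos]
  refine div_le_div_of_nonneg_right (mul_le_mul_of_nonneg_left ?_ Real.pi_pos.le) hβ.le
  rcases h with h | h
  · have hv : ((q₀ 0).val : ℝ) ≤ k := by exact_mod_cast h
    rw [le_abs]
    right
    linarith
  · have hv : (2 * M : ℝ) ≤ ((q₀ 0).val : ℝ) + k + 1 := by exact_mod_cast h
    rw [le_abs]
    left
    linarith

end Samples

/-! ### §2 Third spatial differences on the torus -/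

section Torus

variable {L M : ℕ} [NeZero L] [NeZero M] {c Λ Λ' β μ : ℝ} {K : TrigPolyC4v}

/-- **Third spatial difference of the slice symbol on the torus** (`C³` data of the band): for `e_K = frameLevel μ K` with
`‖D²e_K‖ ≤ K₂`, `‖D³e_K‖ ≤ K₃` and an integer vector `r` (`w = toLp ((2π/L)·r)`),
`‖(Δ_{(0,r̄)})³ Ψ (q)‖ ≤ K₃^Ψ(|De_K(c(q₂))·w| + 3K₂‖w‖²)³ + 3K₂^Ψ(|De_K(c(q₂))·w| + 3K₂‖w‖²)(K₂‖w‖²) + K₁^Ψ(K₃‖w‖³)`.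
[cite: BenfattoGiulianiMastropietro2006, Lemma 2.2 (2.36aa), (2.52)–(2.55)] -/
theorem norm_fwdDiff_three_space_sliceSymbolTorus_le {K₂ K₃ : ℝ} (hK₂ : ∀ p, ‖iteratedFDeriv ℝ 2 (frameLevel μ K) p‖ ≤ K₂)
    (hK₃ : ∀ p, ‖iteratedFDeriv ℝ 3 (frameLevel μ K) p‖ ≤ K₃)
    (hΛ : 0 < Λ) (hΛΛ' : Λ ≤ Λ') (hc : 0 ≤ c) {B₁ B₂ B₃ : ℝ} (hB₁ : ∀ x, |deriv salmhoferCutoff x| ≤ B₁)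
    (hB₂ : ∀ x, |deriv (deriv salmhoferCutoff) x| ≤ B₂) (hB₃ : ∀ x, |deriv (deriv (deriv salmhoferCutoff)) x| ≤ B₃)
    (r : Fin 2 → ℤ) (q : TorusSite 1 (2 * M) × TorusSite 2 L) :
    ‖((fwdDiff ((0 : TorusSite 1 (2 * M)), (fun i => ((r i : ℤ) : ZMod L))))^[3]
        (fun q : TorusSite 1 (2 * M) × TorusSite 2 L =>
          sliceSymbolFnXi c 0 Λ Λ' (matsubaraFreq β M ⟨(q.1 0).val, ZMod.val_lt (q.1 0)⟩) (nambuXiCT L μ K q.2))) q‖ ≤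
      (64 * B₃ + 480 * B₂ + 1728 * B₁ + 1536) * c / Λ ^ 4 *
          (|fderiv ℝ (frameLevel μ K) (WithLp.toLp 2 (torusCentredMomentum L q.2))
              (WithLp.toLp 2 (fun i => 2 * π / L * (r i : ℝ)))| +
            3 * (K₂ * ‖(WithLp.toLp 2 (fun i => 2 * π / L * (r i : ℝ)) : EuclideanSpace ℝ (Fin 2))‖ ^ 2)) ^ 3 +
        3 * ((32 * B₂ + 144 * B₁ + 128) * c / Λ ^ 3 *
          (|fderiv ℝ (frameLevel μ K) (WithLp.toLp 2 (torusCentredMomentum L q.2))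
              (WithLp.toLp 2 (fun i => 2 * π / L * (r i : ℝ)))| +
            3 * (K₂ * ‖(WithLp.toLp 2 (fun i => 2 * π / L * (r i : ℝ)) : EuclideanSpace ℝ (Fin 2))‖ ^ 2)) *
          (K₂ * ‖(WithLp.toLp 2 (fun i => 2 * π / L * (r i : ℝ)) : EuclideanSpace ℝ (Fin 2))‖ ^ 2)) +
        (16 * B₁ + 16) * c / Λ ^ 2 * (K₃ * ‖(WithLp.toLp 2 (fun i => 2 * π / L * (r i : ℝ)) : EuclideanSpace ℝ (Fin 2))‖ ^ 3) := by
  rw [fwdDiff_iter_space_sliceSymbolTorus_eq]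
  exact norm_fwdDiff_three_sliceSymbol_line_le (EngineV8.contDiff_frameLevel μ K) hK₂ hK₃ hΛ hΛΛ' hc hB₁ hB₂ hB₃ _ _

/-- **Third spatial difference on the torus, uniform form**: if `|De_K(c(q₂))·w| ≤ τ` then
`‖(Δ_{(0,r̄)})³ Ψ (q)‖ ≤ K₃^Ψ(τ + 3K₂‖w‖²)³ + 3K₂^Ψ(τ + 3K₂‖w‖²)(K₂‖w‖²) + K₁^Ψ(K₃‖w‖³)`.
[cite: BenfattoGiulianiMastropietro2006, Lemma 2.2 (2.52)–(2.55)] -/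
theorem norm_fwdDiff_three_space_sliceSymbolTorus_le_of_le {K₂ K₃ : ℝ} (hK₂ : ∀ p, ‖iteratedFDeriv ℝ 2 (frameLevel μ K) p‖ ≤ K₂)
    (hK₃ : ∀ p, ‖iteratedFDeriv ℝ 3 (frameLevel μ K) p‖ ≤ K₃)
    (hΛ : 0 < Λ) (hΛΛ' : Λ ≤ Λ') (hc : 0 ≤ c) {B₁ B₂ B₃ : ℝ} (hB₁ : ∀ x, |deriv salmhoferCutoff x| ≤ B₁)
    (hB₂ : ∀ x, |deriv (deriv salmhoferCutoff) x| ≤ B₂) (hB₃ : ∀ x, |deriv (deriv (deriv salmhoferCutoff)) x| ≤ B₃)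
    (r : Fin 2 → ℤ) (q : TorusSite 1 (2 * M) × TorusSite 2 L) {τ : ℝ}
    (hτ : |fderiv ℝ (frameLevel μ K) (WithLp.toLp 2 (torusCentredMomentum L q.2)) (WithLp.toLp 2 (fun i => 2 * π / L * (r i : ℝ)))| ≤ τ) :
    ‖((fwdDiff ((0 : TorusSite 1 (2 * M)), (fun i => ((r i : ℤ) : ZMod L))))^[3]
        (fun q : TorusSite 1 (2 * M) × TorusSite 2 L =>
          sliceSymbolFnXi c 0 Λ Λ' (matsubaraFreq β M ⟨(q.1 0).val, ZMod.val_lt (q.1 0)⟩) (nambuXiCT L μ K q.2))) q‖ ≤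
      (64 * B₃ + 480 * B₂ + 1728 * B₁ + 1536) * c / Λ ^ 4 *
          (τ + 3 * (K₂ * ‖(WithLp.toLp 2 (fun i => 2 * π / L * (r i : ℝ)) : EuclideanSpace ℝ (Fin 2))‖ ^ 2)) ^ 3 +
        3 * ((32 * B₂ + 144 * B₁ + 128) * c / Λ ^ 3 *
          (τ + 3 * (K₂ * ‖(WithLp.toLp 2 (fun i => 2 * π / L * (r i : ℝ)) : EuclideanSpace ℝ (Fin 2))‖ ^ 2)) *
          (K₂ * ‖(WithLp.toLp 2 (fun i => 2 * π / L * (r i : ℝ)) : EuclideanSpace ℝ (Fin 2))‖ ^ 2)) +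
        (16 * B₁ + 16) * c / Λ ^ 2 * (K₃ * ‖(WithLp.toLp 2 (fun i => 2 * π / L * (r i : ℝ)) : EuclideanSpace ℝ (Fin 2))‖ ^ 3) := by
  rw [fwdDiff_iter_space_sliceSymbolTorus_eq]
  exact norm_fwdDiff_three_sliceSymbol_line_le_of_le (EngineV8.contDiff_frameLevel μ K) hK₂ hK₃ hΛ hΛΛ' hc hB₁ hB₂ hB₃ _ _ hτ

/-! ### §3 Third time differences on the torus -/

/-- Beyond the three-step window the sample vanishes: if `Λ′ < π(2M−5)/β` and `val q₀ ≤ 2 ∨ 2M ≤ val q₀ + 3`, the symbol at `q₀` is zero.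
[cite: Salmhofer1999, §4.2.5 (4.71)] -/
theorem sliceSymbolTorus_eq_zero_of_seam₃ (hβ : 0 < β) (hΛ : 0 < Λ) (hΛΛ' : Λ ≤ Λ') (hM : Λ' < π * (2 * M - 5) / β)
    (q₀ : TorusSite 1 (2 * M)) (h : (q₀ 0).val ≤ 2 ∨ 2 * M ≤ (q₀ 0).val + 2 + 1) (ξ : ℝ) :
    sliceSymbolFnXi c 0 Λ Λ' (matsubaraFreq β M ⟨(q₀ 0).val, ZMod.val_lt (q₀ 0)⟩) ξ = 0 := by
  rw [← sliceSymbolFn_eq_sliceSymbolFnXi, matsubaraFreq_val_eq_gridFreq]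
  have hge := abs_gridFreq_ge_of_le (M := M) hβ 2 q₀ h
  have hM' : π * (2 * M - 5) / β = π * (2 * M - 2 * (2 : ℕ) - 1) / β := by push_cast; ring
  exact sliceSymbolFn_eq_zero_of_lt hΛ hΛΛ' c ξ (lt_of_lt_of_le (hM.trans_eq hM') hge)

omit [NeZero L] in
/-- **Third time difference of the slice symbol on the torus**: for `0 < β`, `0 < Λ ≤ Λ′ < π(2M−5)/β`,
`‖(Δ_{(1,0)})³ Ψ (q)‖ ≤ (2π/β)³·(64B₃+480B₂+1728B₁+1536)c/Λ⁴` at EVERY point (inside the window the four frequencies are consecutive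
Matsubara frequencies; at the seam all four samples vanish). [cite: BenfattoGiulianiMastropietro2006, Lemma 2.2 (2.52)] -/
theorem norm_fwdDiff_three_time_sliceSymbolTorus_le (hβ : 0 < β) (hΛ : 0 < Λ) (hΛΛ' : Λ ≤ Λ') (hM : Λ' < π * (2 * M - 5) / β)
    (hc : 0 ≤ c) {B₁ B₂ B₃ : ℝ} (hB₁ : ∀ x, |deriv salmhoferCutoff x| ≤ B₁) (hB₂ : ∀ x, |deriv (deriv salmhoferCutoff) x| ≤ B₂)
    (hB₃ : ∀ x, |deriv (deriv (deriv salmhoferCutoff)) x| ≤ B₃) (q : TorusSite 1 (2 * M) × TorusSite 2 L) :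
    ‖((fwdDiff ((fun _ : Fin 1 => (1 : ZMod (2 * M))), (0 : TorusSite 2 L)))^[3]
        (fun q : TorusSite 1 (2 * M) × TorusSite 2 L =>
          sliceSymbolFnXi c 0 Λ Λ' (matsubaraFreq β M ⟨(q.1 0).val, ZMod.val_lt (q.1 0)⟩) (nambuXiCT L μ K q.2))) q‖ ≤
      (2 * π / β) ^ 3 * ((64 * B₃ + 480 * B₂ + 1728 * B₁ + 1536) * c / Λ ^ 4) := by
  have hB10 : 0 ≤ B₁ := (abs_nonneg _).trans (hB₁ 0)
  have hB20 : 0 ≤ B₂ := (abs_nonneg _).trans (hB₂ 0)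
  have hB30 : 0 ≤ B₃ := (abs_nonneg _).trans (hB₃ 0)
  have hMge : 3 ≤ M := by
    by_contra hlt3
    have hM2 : (M : ℝ) ≤ 2 := by exact_mod_cast (by omega : M ≤ 2)
    have h1 : Λ' * β < π * (2 * (M : ℝ) - 5) := (lt_div_iff₀ hβ).1 hM
    nlinarith [Real.pi_pos, mul_pos (hΛ.trans_le hΛΛ') hβ]
  rw [fwdDiff_iter_prod_fst]
  set ξ := nambuXiCT L μ K q.2 with hξ
  set u : TorusSite 1 (2 * M) := fun _ => (1 : ZMod (2 * M)) with hu
  by_cases hin : (q.1 0).val + 3 < 2 * M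
  · -- inside the window: four consecutive Matsubara frequencies
    have hs : ∀ k ≤ 3, (fun a : TorusSite 1 (2 * M) => sliceSymbolFnXi c 0 Λ Λ' (matsubaraFreq β M ⟨(a 0).val, ZMod.val_lt (a 0)⟩) ξ)
        (q.1 + k • u) = sliceSymbolFn c 0 Λ Λ' ξ (gridFreq M (2 * M) β q.1 + k • (2 * π / β)) := by
      intro k hk
      dsimp only
      rw [← sliceSymbolFn_eq_sliceSymbolFnXi, matsubaraFreq_val_eq_gridFreq, hu, gridFreq_add_smul β q.1 k (by omega), nsmul_eq_mul]
    rw [fwdDiff_iter_eq_of_samples_eq u (2 * π / β) _ (sliceSymbolFn c 0 Λ Λ' ξ) 3 q.1 (gridFreq M (2 * M) β q.1) hs]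
    exact norm_fwdDiff_iter_three_sliceSymbolFn_le hΛ hΛΛ' (abs_zero_le_quarter hΛ) hc hB₁ hB₂ hB₃ (by positivity) _
  · -- at the seam: all four samples vanish
    have hval : ∀ k ≤ 3, ((q.1 + k • u) 0).val ≤ 2 ∨ 2 * M ≤ ((q.1 + k • u) 0).val + 2 + 1 := by
      intro k hk
      have hv : ((q.1 + k • u) 0).val = ((q.1 0).val + k) % (2 * M) := by
        rw [Pi.add_apply, hu, smul_const_one_apply, ZMod.val_add, ZMod.val_natCast, Nat.add_mod_mod]
      rw [hv]
      have hlt := ZMod.val_lt (q.1 0)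
      by_cases hwrap : (q.1 0).val + k < 2 * M
      · right; rw [Nat.mod_eq_of_lt hwrap]; omega
      · left
        have : (q.1 0).val + k - 2 * M < 2 * M := by omega
        rw [show (q.1 0).val + k = ((q.1 0).val + k - 2 * M) + 2 * M by omega, Nat.add_mod_right, Nat.mod_eq_of_lt this]
        omega
    have hs : ∀ k ≤ 3, (fun a : TorusSite 1 (2 * M) => sliceSymbolFnXi c 0 Λ Λ' (matsubaraFreq β M ⟨(a 0).val, ZMod.val_lt (a 0)⟩) ξ)
        (q.1 + k • u) = 0 := fun k hk => sliceSymbolTorus_eq_zero_of_seam₃ (c := c) hβ hΛ hΛΛ' hM (q.1 + k • u) (hval k hk) ξ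
    rw [fwdDiff_iter_eq_zero_of_samples_eq_zero u _ 3 q.1 hs, norm_zero]
    positivity

end Torus

end Summit.HubbardSuperconductivity.HubbardSuperconductivity.Theorems.TorusFourierL2

end
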